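import Mathlib
import Summits.Ventures.PercRepro2.SwOutJunctionsAsym
import Summits.Ventures.PercRepro2.SwOutJunctionGTyped

/-!
# The multi-junction theorem on the general doubly typed side, I: the transport to the graph split at a set of junctions (blind cell PercRepro2, night-4 g31, 2026-08-28; proofs/NIGHT4-G31.md §6c)

g11's multi-junction theorem (an INDEPENDENT set `J` of junctions) on g7's `gTypedQ`: the five
conditions transport to the graph split at the MATCHED junctions on the fine configurations — the
clusters of `h` read on `inl` are the clusters of `h` without the matched junctions
(`setOf_inl_mem_cluster_h_splitS`), so `𝓓″`, `𝓤′`, `X` must be blind to `J`.  The rest is g30's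
asymmetric proof with `card_orbit_le_g`: **`rigidOK_g_of_junctions`**, **`gTypedSwAll_of_junctions`**
(g11's class B2 for g7's row — the transliteration g30 left open).
-/

namespace Summit.Ventures.PercRepro2

namespace LocRows

open Hull

variable {V : Type*} {E : Type*} [Fintype E] [DecidableEq E]

open scoped Classical

variable {ends : E → Sym2 V} {U : Set V} {ξ : Config E} {l h : V} {J : Set V}
  {𝓤 𝓓 𝓓'' : Set (Set V)} {X : Set V} {𝓤' : Set (Set V)}

section PullS

variable {S : Set V}

omit [Fintype E] [DecidableEq E] in
/-- On an `S`-fine configuration the red cluster of `h` in the split graph, read on `inl`, is the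
red cluster of `h` without `S` (`S` independent, `h ∉ S`). -/
lemma setOf_inl_mem_cluster_h_splitS (hind : IndepSet ends S) (hhS : h ∉ S) {η : Config E}
    (hf : MFine ends S h η) :
    {x | Sum.inl x ∈ cluster (splitEndsS ends S) η (Sum.inl h)} = cluster ends η h \ S := by
  ext x
  simp only [Set.mem_setOf_eq, Set.mem_sdiff]
  rw [cluster_eq_insert_ends_redEdges (ends := splitEndsS ends S),
    cluster_eq_insert_ends_redEdges (ends := ends), ← redEdges_eq_of_mfine hind hhS hf]
  simp only [Set.mem_insert_iff, Set.mem_setOf_eq, Sum.inl.injEq]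
  constructor
  · rintro (rfl | ⟨e, he, hxe⟩)
    · exact ⟨Or.inl rfl, hhS⟩
    · rw [inl_mem_splitEndsS_iff] at hxe
      exact ⟨Or.inr ⟨e, he, hxe.1⟩, hxe.2⟩
  · rintro ⟨rfl | ⟨e, he, hxe⟩, hxS⟩
    · exact Or.inl rfl
    · exact Or.inr ⟨e, he, inl_mem_splitEndsS_iff.2 ⟨hxe, hxS⟩⟩

/-- **The general doubly typed side passes to the split** on `S`-fine configurations (`l ∉ S`,
the conditions on `h`'s clusters blind to `S`). -/
theorem mem_gTypedQ_splitS_of_mem (hind : IndepSet ends S) (hlS : l ∉ S) (hhS : h ∉ S)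
    (h𝓓'' : IsLowerSet 𝓓'') (hU' : ∀ T ∈ 𝓤', T \ S ∈ 𝓤') {η : Config E}
    (hf : MFine ends S h η) (hQ : η ∈ gTypedQ ends l h 𝓤 𝓓 𝓓'' X 𝓤') :
    η ∈ gTypedQ (splitEndsS ends S) (Sum.inl l) (Sum.inl h) (pullInl E 𝓤) (pullInl E 𝓓)
      (pullInl E 𝓓'') (Sum.inl '' X) (pullInl E 𝓤') := by
  rw [mem_gTypedQ] at hQ ⊢
  obtain ⟨hhl, hA, hB, hRh, hX, hBh⟩ := hQ
  have hhA' : Sum.inl h ∉ cluster (splitEndsS ends S) η (Sum.inl l) :=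
    fun h' => hhl (Or.inl (conn_of_conn_splitS_inl hind h'))
  have hhB' : Sum.inl h ∉ cluster (splitEndsS ends S) (blue η) (Sum.inl l) :=
    fun h' => hhl (Or.inr (conn_of_conn_splitS_inl hind h'))
  have eRh := setOf_inl_mem_cluster_h_splitS hind hhS hf
  have eBh := setOf_inl_mem_cluster_h_splitS hind hhS (mfine_blue_iff.2 hf)
  refine ⟨?_, ?_, ?_, ?_, ?_, ?_⟩
  · rintro (h1 | h1)
    · exact hhA' h1
    · exact hhB' h1
  · show {x | Sum.inl x ∈ cluster (splitEndsS ends S) η (Sum.inl l)} ∈ 𝓤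
    rw [setOf_inl_mem_cluster_splitS hind hlS hf hhA']; exact hA
  · show {x | Sum.inl x ∈ cluster (splitEndsS ends S) (blue η) (Sum.inl l)} ∈ 𝓓
    rw [setOf_inl_mem_cluster_splitS hind hlS (mfine_blue_iff.2 hf) hhB']; exact hB
  · show {x | Sum.inl x ∈ cluster (splitEndsS ends S) η (Sum.inl h)} ∈ 𝓓''
    rw [eRh]; exact h𝓓'' Set.sdiff_subset hRh
  · rintro x' ⟨x, hxX, rfl⟩ (h1 | h1)
    · have : x ∈ cluster ends η h \ S := by rw [← eRh]; exact h1
      exact hX x hxX (Or.inl this.1)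
    · have : x ∈ cluster ends (blue η) h \ S := by rw [← eBh]; exact h1
      exact hX x hxX (Or.inr this.1)
  · show {x | Sum.inl x ∈ cluster (splitEndsS ends S) (blue η) (Sum.inl h)} ∈ 𝓤'
    rw [eBh]; exact hU' _ hBh

/-- **The general doubly typed side comes back from the split** on `S`-fine configurations. -/
theorem mem_gTypedQ_of_mem_splitS (hind : IndepSet ends S) (hlS : l ∉ S) (hhS : h ∉ S)
    (h𝓓'' : IsLowerSet 𝓓'') (h𝓤' : IsUpperSet 𝓤') (hD'' : ∀ T ∈ 𝓓'', T ∪ S ∈ 𝓓'')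
    (hSX : ∀ u ∈ S, u ∉ X) {η : Config E} (hf : MFine ends S h η)
    (hQ : η ∈ gTypedQ (splitEndsS ends S) (Sum.inl l) (Sum.inl h) (pullInl E 𝓤) (pullInl E 𝓓)
      (pullInl E 𝓓'') (Sum.inl '' X) (pullInl E 𝓤')) :
    η ∈ gTypedQ ends l h 𝓤 𝓓 𝓓'' X 𝓤' := by
  rw [mem_gTypedQ] at hQ ⊢
  obtain ⟨hhl, hA, hB, hRh, hX, hBh⟩ := hQ
  have hhA' : Sum.inl h ∉ cluster (splitEndsS ends S) η (Sum.inl l) := fun h' => hhl (Or.inl h')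
  have hhB' : Sum.inl h ∉ cluster (splitEndsS ends S) (blue η) (Sum.inl l) :=
    fun h' => hhl (Or.inr h')
  have eA := setOf_inl_mem_cluster_splitS hind hlS hf hhA'
  have eB := setOf_inl_mem_cluster_splitS hind hlS (mfine_blue_iff.2 hf) hhB'
  have eRh := setOf_inl_mem_cluster_h_splitS hind hhS hf
  have eBh := setOf_inl_mem_cluster_h_splitS hind hhS (mfine_blue_iff.2 hf)
  refine ⟨?_, ?_, ?_, ?_, ?_, ?_⟩
  · rintro (h1 | h1)
    · rw [← eA] at h1; exact hhA' h1
    · rw [← eB] at h1; exact hhB' h1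
  · rw [← eA]; exact hA
  · rw [← eB]; exact hB
  · have h1 : cluster ends η h \ S ∈ 𝓓'' := by rw [← eRh]; exact hRh
    have h2 := hD'' _ h1
    have hsub : cluster ends η h ⊆ (cluster ends η h \ S) ∪ S := by
      intro x hx
      by_cases hxS : x ∈ S
      · exact Or.inr hxS
      · exact Or.inl ⟨hx, hxS⟩
    exact h𝓓'' hsub h2
  · intro x hxX
    have hxS : x ∉ S := fun h' => hSX x h' hxX
    rintro (h1 | h1)
    · have : Sum.inl x ∈ cluster (splitEndsS ends S) η (Sum.inl h) := by
        show x ∈ {x | Sum.inl x ∈ cluster (splitEndsS ends S) η (Sum.inl h)}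
        rw [eRh]; exact ⟨h1, hxS⟩
      exact hX (Sum.inl x) ⟨x, hxX, rfl⟩ (Or.inl this)
    · have : Sum.inl x ∈ cluster (splitEndsS ends S) (blue η) (Sum.inl h) := by
        show x ∈ {x | Sum.inl x ∈ cluster (splitEndsS ends S) (blue η) (Sum.inl h)}
        rw [eBh]; exact ⟨h1, hxS⟩
      exact hX (Sum.inl x) ⟨x, hxX, rfl⟩ (Or.inr this)
  · have h1 : cluster ends (blue η) h \ S ∈ 𝓤' := by rw [← eBh]; exact hBh
    exact h𝓤' Set.sdiff_subset h1

end PullS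

end LocRows

end Summit.Ventures.PercRepro2
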